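import Summits.ResolutionOfSingularities.ResolutionOfSingularities.Theorems.FrobeniusLadderFInjectiveMacaulayficationFedderOrigin
import Summits.ResolutionOfSingularities.ResolutionOfSingularities.Theorems.FrobeniusLadderFInjectiveMacaulayficationBlowupFiModel
import Summits.ResolutionOfSingularities.ResolutionOfSingularities.Theorems.FrobeniusLadderFInjectiveMacaulayficationQuotLocalizationIso
import Summits.ResolutionOfSingularities.ResolutionOfSingularities.Theorems.FrobeniusLadderFInjectiveMacaulayficationDegreeZeroDescentLocal
import Mathlib.Algebra.Ring.GeomSum
import HarnessLib

/-!
# The K4.5 specimen `T₁₁ = z² + (y²+x³)³ + x¹¹ + w⁷` violates the clause at its origin in characteristic `7` (Fedder)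
# (crux `FInjectiveMacaulayfication` stmt-ResolutionOfSingularities-15315, chain w45a, road B / hole #3γ; seat res-L1-w45a-stub-3)

[OURS · L1 W4.5a] Support file (`--supports stmt-ResolutionOfSingularities-15315 --as helper`); NOT a statement of any manuscript; no named
fact; AI-written (AI review is weaker than expert review).

The deciding kill-test specimen of the chain, `T₁₁ = z² + (y²+x³)³ + x¹¹ + w⁷ ⊂ 𝔸⁴_k`, `char k = 7`, had its origin certified F-BAD by kit only
(res-L1-w45a-tri-1's Fedder census). This file is the kernel fact: **`T₁₁⁶ ∈ (x⁷, y⁷, z⁷, w⁷)`**, hence by Fedder's criterion at the origin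
(`Fedder.fedder_criterion_origin`, already in the tree) the hypersurface local ring at the origin does NOT satisfy the per-stalk clause of the
crux («every system of parameters weakly regular and generating a Frobenius-closed ideal»). So the road-B instance ✓ p525959 (`PFix₇` at the
origin of `T₁₁`) and the FC′/FC″ cylinder instance ✓ p533666 (`T₁₁⁺ × 𝔸¹`) sit at a GENUINELY bad point.

The Fedder membership is proved STRUCTURALLY (no expansion of the 462-term power): with `e := y⁴ + 3y²x³ + 3x⁶`,
`T₁₁ = A + B`, `A := z² + y²·e`, `B := x⁷·(x² + x⁴) + w⁷ ∈ 𝔪^[7]`; `T₁₁⁶ − A⁶ ∈ (B)` (`sub_dvd_pow_sub_pow`);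
`A⁶ = z⁷·(z⁵ + 6z³y²e + 15zy⁴e²) + y⁷·(15z⁴ye⁴ + 6z²y³e⁵ + y⁵e⁶) + 20·z⁶·(y⁶e³)` (binomial theorem, `ring`); and
`y⁶e³ = y⁷·(y⁵g³ + 9y³g²x⁶ + 27yg·x¹²) + x⁷·(27y⁶x¹¹)` with `e = y²g + 3x⁶`, `g := y² + 3x³` (`ring`).

* `t11_pow_six_mem` — `T₁₁⁶ ∈ (x⁷, y⁷, z⁷, w⁷)` over any commutative ring;
* `t11_mem_span_range_X`, `t11_ne_zero` — bookkeeping;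
* `t11_origin_not_clause_local` — `k[x,y,z,w]_{(x,y,z,w)}/(T₁₁)` violates the clause (`char k = 7`);
* `t11_origin_not_clause` — affine form: the local ring of `k[x,y,z,w]/(T₁₁)` at the image of the origin violates the clause
  (transport along `QuotLocalizationIso.stub_quotLocalizationIso`, as in `ThreefoldOriginNotClause` / `E8Char5FiModel`).

[cite: Fedder1983, Prop. 1.7 and Thm. 1.12]
-/

-- single-problem summit: the doubled namespace component is forced
set_option linter.dupNamespace false

noncomputable section

namespace Summit.ResolutionOfSingularities.ResolutionOfSingularities.Theorems.FInjectiveMacaulayfication.T11OriginNotClauseChar7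

open MvPolynomial
open Summit.ResolutionOfSingularities.ResolutionOfSingularities.Theorems.FInjectiveMacaulayfication

/-! ## §1 The Fedder membership `T₁₁⁶ ∈ (x⁷, y⁷, z⁷, w⁷)` -/

section Poly

variable {R : Type} [CommRing R]

/-- Binomial identity: `(z² + y²e)⁶ = z⁷·P + y⁷·Q + 20·z⁶·(y⁶e³)`. [folklore] -/
theorem pow_six_split (z y e : R) :
    (z ^ 2 + y ^ 2 * e) ^ 6 =
      z ^ 7 * (z ^ 5 + 6 * z ^ 3 * y ^ 2 * e + 15 * z * y ^ 4 * e ^ 2) +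
        y ^ 7 * (15 * z ^ 4 * y * e ^ 4 + 6 * z ^ 2 * y ^ 3 * e ^ 5 + y ^ 5 * e ^ 6) +
        20 * z ^ 6 * (y ^ 6 * e ^ 3) := by
  ring

/-- `y⁶·(y²g + 3x⁶)³ = y⁷·(…) + x⁷·(27y⁶x¹¹)`. [folklore] -/
theorem y6_e_cube_split (x y g : R) :
    y ^ 6 * (y ^ 2 * g + 3 * x ^ 6) ^ 3 =
      y ^ 7 * (y ^ 5 * g ^ 3 + 9 * y ^ 3 * g ^ 2 * x ^ 6 + 27 * y * g * x ^ 12) + x ^ 7 * (27 * y ^ 6 * x ^ 11) := by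
  ring

variable (R)

/-- **`T₁₁⁶ ∈ (x⁷, y⁷, z⁷, w⁷)`** over any commutative ring (variables `x, y, z, w = X 0, X 1, X 2, X 3`): the Fedder membership
showing that the origin of `T₁₁` is not F-pure in characteristic `7`. Structured proof: `T₁₁ = A + B` with
`A = z² + y²(y⁴ + 3y²x³ + 3x⁶)`, `B = x⁷(x² + x⁴) + w⁷`; `(A + B)⁶ − A⁶ ∈ (B)`; `A⁶` and `y⁶e³` split as in `pow_six_split`,
`y6_e_cube_split`. [cite: Fedder1983, Prop. 1.7] -/
theorem t11_pow_six_mem :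
    (X 2 ^ 2 + (X 1 ^ 2 + X 0 ^ 3) ^ 3 + X 0 ^ 11 + X 3 ^ 7 : MvPolynomial (Fin 4) R) ^ 6 ∈
      Ideal.span (Set.range fun i : Fin 4 => (X i : MvPolynomial (Fin 4) R) ^ 7) := by
  set I : Ideal (MvPolynomial (Fin 4) R) := Ideal.span (Set.range fun i : Fin 4 => (X i : MvPolynomial (Fin 4) R) ^ 7) with hI
  have hX : ∀ i : Fin 4, (X i : MvPolynomial (Fin 4) R) ^ 7 ∈ I := fun i => Ideal.subset_span ⟨i, rfl⟩
  -- the pieces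
  set x : MvPolynomial (Fin 4) R := X 0
  set y : MvPolynomial (Fin 4) R := X 1
  set z : MvPolynomial (Fin 4) R := X 2
  set w : MvPolynomial (Fin 4) R := X 3
  set g : MvPolynomial (Fin 4) R := y ^ 2 + 3 * x ^ 3 with hg
  set e : MvPolynomial (Fin 4) R := y ^ 2 * g + 3 * x ^ 6 with he
  set A : MvPolynomial (Fin 4) R := z ^ 2 + y ^ 2 * e with hA
  set B : MvPolynomial (Fin 4) R := x ^ 7 * (x ^ 2 + x ^ 4) + w ^ 7 with hB
  have hf : (z ^ 2 + (y ^ 2 + x ^ 3) ^ 3 + x ^ 11 + w ^ 7 : MvPolynomial (Fin 4) R) = A + B := by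
    simp only [hA, hB, he, hg]; ring
  -- `B ∈ I`
  have hBI : B ∈ I := add_mem (Ideal.mul_mem_right _ _ (hX 0)) (hX 3)
  -- `y⁶ e³ ∈ I`
  have hye : y ^ 6 * e ^ 3 ∈ I := by
    rw [he, y6_e_cube_split]
    exact add_mem (Ideal.mul_mem_right _ _ (hX 1)) (Ideal.mul_mem_right _ _ (hX 0))
  -- `A⁶ ∈ I`
  have hA6 : A ^ 6 ∈ I := by
    rw [hA, pow_six_split]
    exact add_mem (add_mem (Ideal.mul_mem_right _ _ (hX 2)) (Ideal.mul_mem_right _ _ (hX 1))) (Ideal.mul_mem_left _ _ hye)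
  -- `(A + B)⁶ − A⁶ ∈ (B) ⊆ I`
  have hdiff : (A + B) ^ 6 - A ^ 6 ∈ I := by
    obtain ⟨q, hq⟩ := sub_dvd_pow_sub_pow (A + B) A 6
    rw [hq, show A + B - A = B by ring]
    exact Ideal.mul_mem_right _ _ hBI
  rw [hf]
  have : (A + B) ^ 6 = ((A + B) ^ 6 - A ^ 6) + A ^ 6 := by ring
  rw [this]
  exact add_mem hdiff hA6

/-- `T₁₁` lies in the ideal of the origin (no constant term). [folklore] -/
theorem t11_mem_span_range_X :
    (X 2 ^ 2 + (X 1 ^ 2 + X 0 ^ 3) ^ 3 + X 0 ^ 11 + X 3 ^ 7 : MvPolynomial (Fin 4) R) ∈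
      Ideal.span (Set.range (X : Fin 4 → MvPolynomial (Fin 4) R)) := by
  have hX : ∀ i : Fin 4, (X i : MvPolynomial (Fin 4) R) ∈ Ideal.span (Set.range (X : Fin 4 → MvPolynomial (Fin 4) R)) :=
    fun i => Ideal.subset_span ⟨i, rfl⟩
  refine add_mem (add_mem (add_mem (Ideal.pow_mem_of_mem _ (hX 2) 2 (by norm_num)) ?_)
    (Ideal.pow_mem_of_mem _ (hX 0) 11 (by norm_num))) (Ideal.pow_mem_of_mem _ (hX 3) 7 (by norm_num))
  exact Ideal.pow_mem_of_mem _ (add_mem (Ideal.pow_mem_of_mem _ (hX 1) 2 (by norm_num))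
    (Ideal.pow_mem_of_mem _ (hX 0) 3 (by norm_num))) 3 (by norm_num)

end Poly

section FieldCase

variable (k : Type) [Field k]

/-- `T₁₁ ≠ 0` over a field: `T₁₁(0,0,1,0) = 1`. [folklore] -/
theorem t11_ne_zero :
    (X 2 ^ 2 + (X 1 ^ 2 + X 0 ^ 3) ^ 3 + X 0 ^ 11 + X 3 ^ 7 : MvPolynomial (Fin 4) k) ≠ 0 := by
  intro h0
  have h1 := congrArg (MvPolynomial.eval (fun j : Fin 4 => if j = 2 then (1 : k) else 0)) h0
  simp only [map_add, map_pow, MvPolynomial.eval_X, Fin.isValue, Fin.reduceEq, ↓reduceIte, map_zero] at h1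
  norm_num at h1

variable [CharP k 7]

/-- **The origin of `T₁₁` violates the crux's clause in characteristic `7`** (local-ring level): for `S = k[x,y,z,w]`,
`P = (x,y,z,w)`, the hypersurface local ring `S_P/(T₁₁)` does NOT satisfy «every system of parameters weakly regular with
Frobenius-closed ideal» — `T₁₁^(7-1) ∈ 𝔪^[7]` (`t11_pow_six_mem`) and Fedder's criterion (`Fedder.fedder_criterion_origin`).
[cite: Fedder1983, Thm. 1.12] -/
theorem t11_origin_not_clause_local (P : Ideal (MvPolynomial (Fin 4) k)) [P.IsMaximal]
    (hP : P = Ideal.span (Set.range (MvPolynomial.X : Fin 4 → MvPolynomial (Fin 4) k)))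
    (f : MvPolynomial (Fin 4) k) (hf : f = X 2 ^ 2 + (X 1 ^ 2 + X 0 ^ 3) ^ 3 + X 0 ^ 11 + X 3 ^ 7) :
    ¬ (∀ d : ℕ, ringKrullDim (Localization.AtPrime P ⧸ Ideal.span {algebraMap (MvPolynomial (Fin 4) k)
        (Localization.AtPrime P) f}) = d →
      ∀ s : Fin d → Localization.AtPrime P ⧸ Ideal.span {algebraMap (MvPolynomial (Fin 4) k)
          (Localization.AtPrime P) f},
        Ideal.IsMaximal (Ideal.radical (Ideal.span (Set.range s))) →
          RingTheory.Sequence.IsWeaklyRegular (Localization.AtPrime P ⧸ Ideal.span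
              {algebraMap (MvPolynomial (Fin 4) k) (Localization.AtPrime P) f}) (List.ofFn s) ∧
          ∀ y : Localization.AtPrime P ⧸ Ideal.span {algebraMap (MvPolynomial (Fin 4) k)
              (Localization.AtPrime P) f},
            (∃ e : ℕ, y ^ 7 ^ e ∈ Ideal.span ((fun z : Localization.AtPrime P ⧸ Ideal.span
                {algebraMap (MvPolynomial (Fin 4) k) (Localization.AtPrime P) f} => z ^ 7 ^ e) ''
                  (Ideal.span (Set.range s) : Set (Localization.AtPrime P ⧸ Ideal.span
                    {algebraMap (MvPolynomial (Fin 4) k) (Localization.AtPrime P) f})))) →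
              y ∈ Ideal.span (Set.range s)) := by
  haveI : Fact (Nat.Prime 7) := ⟨by norm_num⟩
  have hfP : f ∈ P := by
    rw [hP, hf]
    exact t11_mem_span_range_X k
  have hf0 : f ≠ 0 := by
    rw [hf]
    exact t11_ne_zero k
  rw [Fedder.fedder_criterion_origin 7 k 4 P hP f hfP hf0, not_not, hf, show (7 : ℕ) - 1 = 6 from rfl]
  exact t11_pow_six_mem k

/-- **THE K4.5 SPECIMEN `T₁₁` IS F-BAD AT ITS ORIGIN (char `7`), affine form**: the local ring of `k[x,y,z,w]/(T₁₁)` at the image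
`𝔪̄` of `(x,y,z,w)` (a maximal ideal) violates the clause — `t11_origin_not_clause_local` transported along
`k[X]_{(X)}/(f) ≅ (k[X]/(f))_{𝔪̄}` (`QuotLocalizationIso.stub_quotLocalizationIso`, `DegreeZeroDescent.inlineClause_of_ringEquiv`).
So the road-B point-fix ✓ p525959 and the FC′ cylinder instance ✓ p533666 concern a genuinely bad point. [cite: Fedder1983, Thm. 1.12] -/
theorem t11_origin_not_clause (f : MvPolynomial (Fin 4) k)
    (hf : f = X 2 ^ 2 + (X 1 ^ 2 + X 0 ^ 3) ^ 3 + X 0 ^ 11 + X 3 ^ 7) :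
    ∃ (P : Ideal (MvPolynomial (Fin 4) k ⧸ Ideal.span {f})) (_ : P.IsMaximal),
      P = (Ideal.span (Set.range (MvPolynomial.X : Fin 4 → MvPolynomial (Fin 4) k))).map (Ideal.Quotient.mk (Ideal.span {f})) ∧
      ¬ (∀ d : ℕ, ringKrullDim (Localization.AtPrime P) = d → ∀ s : Fin d → Localization.AtPrime P,
        (Ideal.span (Set.range s)).radical.IsMaximal →
          RingTheory.Sequence.IsWeaklyRegular (Localization.AtPrime P) (List.ofFn s) ∧
          ∀ y : Localization.AtPrime P, (∃ e : ℕ, y ^ 7 ^ e ∈ Ideal.span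
            ((fun z : Localization.AtPrime P => z ^ 7 ^ e) ''
              (Ideal.span (Set.range s) : Set (Localization.AtPrime P)))) → y ∈ Ideal.span (Set.range s)) := by
  haveI : Fact (Nat.Prime 7) := ⟨by norm_num⟩
  haveI hmax : (Ideal.span (Set.range (MvPolynomial.X : Fin 4 → MvPolynomial (Fin 4) k))).IsMaximal :=
    Fedder.isMaximal_span_range_X k 4
  have hfm : f ∈ Ideal.span (Set.range (MvPolynomial.X : Fin 4 → MvPolynomial (Fin 4) k)) := by
    rw [hf]
    exact t11_mem_span_range_X k
  have hker : RingHom.ker (Ideal.Quotient.mk (Ideal.span {f})) ≤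
      Ideal.span (Set.range (MvPolynomial.X : Fin 4 → MvPolynomial (Fin 4) k)) := by
    rw [Ideal.mk_ker, Ideal.span_singleton_le_iff_mem]
    exact hfm
  obtain ⟨hPmax, hcomap⟩ := BlowupFiModel.isMaximal_map_and_comap_map_of_surjective
    (Ideal.Quotient.mk (Ideal.span {f})) Ideal.Quotient.mk_surjective
    (Ideal.span (Set.range (MvPolynomial.X : Fin 4 → MvPolynomial (Fin 4) k))) hker
  haveI := hPmax
  refine ⟨_, hPmax, rfl, fun hclause => ?_⟩
  obtain ⟨e⟩ := QuotLocalizationIso.stub_quotLocalizationIso (MvPolynomial (Fin 4) k) f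
    (Ideal.span (Set.range (MvPolynomial.X : Fin 4 → MvPolynomial (Fin 4) k))) _ hcomap
  have key := DegreeZeroDescent.inlineClause_of_ringEquiv 7 e.symm hclause
  exact t11_origin_not_clause_local k _ rfl f hf key

end FieldCase

end Summit.ResolutionOfSingularities.ResolutionOfSingularities.Theorems.FInjectiveMacaulayfication.T11OriginNotClauseChar7

end
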